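import Summits.CriticalPhenomena.CardyFormulaZ2.Theses.CardyBondTriangular
import Summits.CriticalPhenomena.CardyFormulaZ2.Theses.CardyIsoradial
import Summits.CriticalPhenomena.CardyFormulaZ2.Theorems.CardyBondTriangularTriIsoradialInstance
import Literature.Probability.LatticeModels.IsoradialGraphsProofs
import Literature.Probability.LatticeModels.IsoradialPercolationProofs
import Literature.Probability.Percolation.IsoradialProofs
import Literature.Probability.LatticeModels.LatticeGraph
import HarnessLib

/-!
# Route CardyBondTriangular — crux `TriangularToSquareTransport` from `CrossingLimitInvariance`

Cross-route reduction recorded in the route header of `CardyBondTriangular` ("Implied by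
CrossingLimitInvariance (stmt-0785) + TriIsoradialInstance + the square-lattice instance facts"):
the crux `TriangularToSquareTransport` (item stmt-CriticalPhenomena-4665) is the `(𝕋, ℤ²)`
specialisation of route `CardyIsoradial`'s crux `CrossingLimitInvariance`
(stmt-CriticalPhenomena-0785, universality of crossing-probability scaling limits across
Grimmett–Manolescu's class `𝒢`). Both endpoints are members of `𝒢` by theorems of the tree:

* `𝕋` with the drawing `z x = √3 (triEmbed x − (1 + ζ)/3)`: `triIsoradialInstance_proof`
  (item stmt-CriticalPhenomena-4667, closed);
* `ℤ²` with `squareLatticeEmbedding`: `zdGraph_preconnected_holds`,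
  `isIsoradial_squareLatticeEmbedding_holds`, `isRhombicTiling_squareLatticeEmbedding_holds`,
  `hasSquareGridProperty_squareLattice_holds`, `hasBoundedAngles_squareLatticeEmbedding_holds`
  (at `ε = π/4`) and `RhombicEmbedding.isoradialPercolation_squareLattice_holds` (canonical law
  `= bondPercolation (zdGraph 2) half`).

So `CrossingLimitInvariance → TriangularToSquareTransport`, unconditionally in everything else.
This does not close the crux (stmt-0785 is open and strictly stronger: it ranges over all of `𝒢`,
aperiodic rhombic tilings included); it is landed as a `--supports` lemma so that a proof of
stmt-0785 closes stmt-4665 by one `exact`.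

Reference: G. R. Grimmett, I. Manolescu, *Bond percolation on isoradial graphs: criticality and
universality*, PTRF 159 (2014), §1 (the class `𝒢` contains `ℤ²` and `𝕋`).
-/

namespace Summit.CriticalPhenomena.CardyFormulaZ2.Theorems

open Literature.Probability.LatticeModels Literature.Probability.Percolation

/-- **`CrossingLimitInvariance → TriangularToSquareTransport`.** If crossing-probability scaling
limits of the crude event `embDomainCrossing` are universal across Grimmett–Manolescu's class `𝒢`
(route `CardyIsoradial`, crux `CrossingLimitInvariance`, stmt-CriticalPhenomena-0785), then in
particular whatever crude crossing limits `Φ(η)` canonical bond percolation on `𝕋` (drawing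
`√3 (triEmbed − (1 + ζ)/3)`) has for all conformal rectangles, bond percolation on `ℤ²` at
`p = 1/2` (drawing `squareLatticeEmbedding.z`) has the same (crux `TriangularToSquareTransport`,
stmt-CriticalPhenomena-4665). Proof: instantiate the universality statement at the two members of
`𝒢` given by `triIsoradialInstance_proof` and the six square-lattice instance theorems, and rewrite
the canonical laws and the drawings. -/
theorem triangularToSquareTransport_of_crossingLimitInvariance
    (hCLI : Summit.CriticalPhenomena.CardyFormulaZ2.Theses.CardyIsoradial.CrossingLimitInvariance) :
    Summit.CriticalPhenomena.CardyFormulaZ2.Theses.CardyBondTriangular.TriangularToSquareTransport := by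
  unfold Summit.CriticalPhenomena.CardyFormulaZ2.Theses.CardyBondTriangular.TriangularToSquareTransport
  intro Φ hT R
  obtain ⟨hpre, emb, hz, hiso, htile, hsgp, hbap, hlaw⟩ := triIsoradialInstance_proof
  have hT' : ∀ R : Literature.Probability.RandomPlanarGeometry.ConformalRectangle,
      R.HasCrossingLimit (fun δ ↦ emb.isoradialPercolation.real
        (embDomainCrossing emb.z R.carrier δ (R.arc 0) (R.arc 2))) Φ := by
    intro R'
    rw [hz, hlaw]
    exact hT R'
  have h := hCLI Φ (Site 2) HexVertex triGraph emb hpre hiso htile hsgp (Real.pi / 6)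
    (by positivity) hbap hT' (Site 2) (Site 2) (zdGraph 2) squareLatticeEmbedding
    zdGraph_preconnected_holds isIsoradial_squareLatticeEmbedding_holds
    isRhombicTiling_squareLatticeEmbedding_holds hasSquareGridProperty_squareLattice_holds
    (Real.pi / 4) (by positivity) (hasBoundedAngles_squareLatticeEmbedding_holds le_rfl) R
  rwa [RhombicEmbedding.isoradialPercolation_squareLattice_holds] at h

end Summit.CriticalPhenomena.CardyFormulaZ2.Theorems
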